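import Mathlib.Analysis.Fourier.AddCircle
import Literature.Analysis.SpecialFunctions.OblateSpheroidalEigenvalueBound
import Literature.Analysis.FunctionSpaces.L2ProductHilbertBasis
import HarnessLib

/-!
# The oblate spheroidal harmonics as a Hilbert basis of `L²` of the sphere

Dafermos–Rodnianski–Shlapentokh-Rothman, *Decay for solutions of the wave equation on Kerr
exterior spacetimes III*, arXiv:1402.7034, §5.2.1 (PDF p. 20): for every real `ν = aω` the
eigenfunctions `S_{mℓ}(ν, cos θ) e^{imφ}` of the oblate spheroidal operator
`P(ν) = -(1/sin θ) ∂_θ (sin θ ∂_θ) - ∂_φ²/sin²θ - ν² cos²θ` form a complete orthonormal basis of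
`L²(sin θ dθ dφ)`, with eigenvalues `λ_{mℓ}(ν)` satisfying `λ_{mℓ}(ν) + ν² ≥ |m|(|m|+1)` ((33)).

In the variable `x = cos θ` the measure `sin θ dθ dφ` becomes `dx dφ` on `[-1, 1] × 𝕋`; this file
assembles the basis on `L²(legendreMeasure.prod haarAddCircle)` (circle of arbitrary length
`T`, Haar probability measure; the Kerr application takes `T = 2π`) from the azimuthal sectors
of `OblateSpheroidalCompletenessAzimuthal` (`exists_hilbertBasis_oblateSpheroidal m ν`, one
Hilbert basis of `L²([-1,1])` per `|m|`) and the Fourier basis `fourierBasis` of `L²(𝕋)`, via the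
fibred product basis `fibredTensorBasis` of `FunctionSpaces/L2ProductHilbertBasis`.

* `oblateSectorSet m ν`, `oblateSectorBasis m ν`, `oblateSectorEig m ν` — a choice of the sector
  data of `exists_hilbertBasis_oblateSpheroidal m ν` with its four properties
  (`coe_oblateSectorBasis`, `tendsto_oblateSectorEig`, `le_oblateSectorEig`,
  `oblateSector_weak`, `oblateSector_weak_poly`).
* `sphereMeasure T = legendreMeasure.prod haarAddCircle`, `mulSqFst` (multiplication by `x²` in
  the first variable, `mulSqFst_tensorLp`), `bddMul` (multiplication by a bounded measurable real
  weight on `L²` of an arbitrary measure; `coeFn_bddMul`, `inner_bddMul`, `isSelfAdjoint_bddMul`).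
* `OblateSphereIndex ν = Σ m : ℤ, oblateSectorSet m.natAbs ν`, and the **main objects**:
  `oblateSphereBasis ν : HilbertBasis (OblateSphereIndex ν) ℂ (Lp ℂ 2 (sphereMeasure T))` with
  `oblateSphereBasis_apply` (`Ψ_{⟨m, j⟩} = S^{(|m|)}_j ⊗ e_m`), eigenvalues `oblateSphereEig ν`,
  the bound `le_oblateSphereEig` (`|m|(|m|+1) - ν² ≤ λ`, DRSR (33)), `tendsto_oblateSphereEig`
  (`λ → ∞` along the cofinite filter of the whole index set), and the **weak eigen-equation**
  `oblateSphere_weak` against the unperturbed spherical-harmonic-type basis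
  `Y_{m,k} = e^{(|m|)}_k ⊗ e_m` (`sphHarmTensor`):
  `Λ_{|m|,k} ⟪Y_{m,k}, Ψ⟫ - ν² ⟪Y_{m,k}, x² Ψ⟫ = λ ⟪Y_{m,k}, Ψ⟫`, `Λ_{m,k} = (k+m)(k+m+1)`, and its
  polynomial-test-function form `oblateSphere_weak_poly`.

Both printed bounds are available: (33) as above and (34) `2|m||ν| - ν² ≤ λ`
(`two_mul_abs_le_oblateSectorEig`, `two_mul_abs_le_oblateSphereEig`, from
`OblateSpheroidalEigenvalueBound`). The regularity of the `S_{mℓ}` and the transfer to the round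
sphere / to the Kerr `(θ, φ)` coordinates are not treated here.

## Mathlib / tree search

Mathlib has `fourierBasis : HilbertBasis ℤ ℂ (Lp ℂ 2 haarAddCircle)` (`coe_fourierBasis`,
`orthonormal_fourier`); no spheroidal or spherical harmonics as `L²` bases (searched
`spheroidal`, `sphericalHarmonic`, `HilbertBasis.*sphere`). Tree: the sector theory
(`OblateSpheroidalCompleteness*`, `AssociatedLegendreHilbertBasis`), the product-basis engine
(`L2ProductHilbertBasis`), and the ODE-side spheroidal files `SpheroidalHarmonic*.lean`
(shooting eigenfunctions `sphmEig`, not used here).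

## References

* M. Dafermos, I. Rodnianski, Y. Shlapentokh-Rothman, arXiv:1402.7034, §5.2.1, (32)–(33),
  PDF p. 20. [DafermosRodnianskiShlapentokhrothman2014]
* M. Reed, B. Simon, *Methods of Modern Mathematical Physics I*, §II.4, PDF p. 51 (product
  bases). [ReedSimonI1980]
-/

noncomputable section

open MeasureTheory Set Filter Topology Polynomial
open scoped ENNReal NNReal ComplexConjugate InnerProductSpace

namespace Literature.Analysis.SpecialFunctions

open Literature.Analysis.FunctionSpaces

/-! ### Multiplication by a bounded real weight on `L²` of an arbitrary measure -/

section BddMul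

variable {γ : Type*} [MeasurableSpace γ] (ρ : Measure γ) {w : γ → ℝ} {W : ℝ}

/-- A bounded measurable real weight is in `L^∞(ρ)` (as a complex function). [folklore] -/
theorem memLp_top_of_abs_le (hw : Measurable w) (hb : ∀ z, |w z| ≤ W) :
    MemLp (fun z ↦ ((w z : ℝ) : ℂ)) ∞ ρ :=
  memLp_top_of_bound (Complex.measurable_ofReal.comp hw).aestronglyMeasurable W
    (Eventually.of_forall fun z ↦ by
      rw [Complex.norm_real, Real.norm_eq_abs]
      exact hb z)

/-- The weight as an element of `L^∞(ρ)`. [folklore] -/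
def bddWeight (hw : Measurable w) (hb : ∀ z, |w z| ≤ W) : Lp ℂ ∞ ρ :=
  (memLp_top_of_abs_le ρ hw hb).toLp _

/-- The weight class is represented by `z ↦ w z`. [folklore] -/
theorem coeFn_bddWeight (hw : Measurable w) (hb : ∀ z, |w z| ≤ W) :
    (bddWeight ρ hw hb : γ → ℂ) =ᵐ[ρ] fun z ↦ ((w z : ℝ) : ℂ) :=
  MemLp.coeFn_toLp _

/-- **The multiplication operator `f ↦ w · f` on `L²(ρ)`** by a bounded measurable real weight.
[folklore] -/
def bddMul (hw : Measurable w) (hb : ∀ z, |w z| ≤ W) : Lp ℂ 2 ρ →L[ℂ] Lp ℂ 2 ρ :=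
  (ContinuousLinearMap.mul ℂ ℂ).holderL ρ ∞ 2 2 (bddWeight ρ hw hb)

/-- `(w · f)(z) = w(z) f(z)` a.e. [folklore] -/
theorem coeFn_bddMul (hw : Measurable w) (hb : ∀ z, |w z| ≤ W) (f : Lp ℂ 2 ρ) :
    (bddMul ρ hw hb f : γ → ℂ) =ᵐ[ρ] fun z ↦ ((w z : ℝ) : ℂ) * f z := by
  rw [bddMul, ContinuousLinearMap.holderL_apply_apply]
  filter_upwards [(ContinuousLinearMap.mul ℂ ℂ).coeFn_holder (r := 2) (bddWeight ρ hw hb) f,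
    coeFn_bddWeight ρ hw hb] with z hz hwz
  rw [hz, ContinuousLinearMap.mul_apply', hwz]

/-- `⟨g, w · f⟩ = ∫ conj(g) w f dρ`. [folklore] -/
theorem inner_bddMul (hw : Measurable w) (hb : ∀ z, |w z| ≤ W) (g f : Lp ℂ 2 ρ) :
    ⟪g, bddMul ρ hw hb f⟫_ℂ = ∫ z, conj (g z) * (((w z : ℝ) : ℂ) * f z) ∂ρ := by
  rw [L2.inner_def]
  refine integral_congr_ae ?_
  filter_upwards [coeFn_bddMul ρ hw hb f] with z hz
  rw [RCLike.inner_apply, hz, mul_comm]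

/-- **Multiplication by a real weight is self-adjoint.** [folklore] -/
theorem isSelfAdjoint_bddMul (hw : Measurable w) (hb : ∀ z, |w z| ≤ W) :
    IsSelfAdjoint (bddMul ρ hw hb) := by
  rw [ContinuousLinearMap.isSelfAdjoint_iff_isSymmetric]
  intro f g
  change ⟪bddMul ρ hw hb f, g⟫_ℂ = ⟪f, bddMul ρ hw hb g⟫_ℂ
  rw [← inner_conj_symm, inner_bddMul, inner_bddMul, ← integral_conj]
  refine integral_congr_ae (Eventually.of_forall fun z ↦ ?_)
  simp only [map_mul, Complex.conj_conj, Complex.conj_ofReal]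
  ring

/-- Symmetry of the multiplication operator in inner products. [folklore] -/
theorem inner_bddMul_comm (hw : Measurable w) (hb : ∀ z, |w z| ≤ W) (f g : Lp ℂ 2 ρ) :
    ⟪bddMul ρ hw hb f, g⟫_ℂ = ⟪f, bddMul ρ hw hb g⟫_ℂ :=
  (ContinuousLinearMap.isSelfAdjoint_iff_isSymmetric.1 (isSelfAdjoint_bddMul ρ hw hb)) f g

end BddMul

/-! ### The azimuthal sectors: a choice of the data of `exists_hilbertBasis_oblateSpheroidal` -/

section Sector

variable (m : ℕ) (ν : ℝ)

/-- The index set (a subset of `L²([-1,1])`) of the oblate spheroidal eigenbasis of the sector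
`m`. [cite: DafermosRodnianskiShlapentokhrothman2014, §5.2.1 (32)] -/
def oblateSectorSet : Set (Lp ℂ 2 legendreMeasure) :=
  (exists_hilbertBasis_oblateSpheroidal m ν).choose

/-- **The oblate spheroidal eigenbasis `(S^{(m)}_j)_j` of the sector `m`**, a Hilbert basis of
`L²([-1, 1])`. [cite: DafermosRodnianskiShlapentokhrothman2014, §5.2.1 (32)] -/
def oblateSectorBasis : HilbertBasis (oblateSectorSet m ν) ℂ (Lp ℂ 2 legendreMeasure) :=
  (exists_hilbertBasis_oblateSpheroidal m ν).choose_spec.choose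

/-- **The oblate spheroidal eigenvalues `λ^{(m)}_j(ν)` of the sector `m`.**
[cite: DafermosRodnianskiShlapentokhrothman2014, §5.2.1 (32)] -/
def oblateSectorEig : oblateSectorSet m ν → ℝ :=
  (exists_hilbertBasis_oblateSpheroidal m ν).choose_spec.choose_spec.choose

/-- The defining properties of the chosen sector data. [folklore] -/
theorem oblateSector_spec :
    ⇑(oblateSectorBasis m ν) = ((↑) : oblateSectorSet m ν → Lp ℂ 2 legendreMeasure) ∧
    Tendsto (oblateSectorEig m ν) cofinite atTop ∧
    (∀ j, (m : ℝ) * (m + 1) - ν ^ 2 ≤ oblateSectorEig m ν j) ∧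
    ∀ j (k : ℕ), (assocLegLevel m k : ℂ) * ⟪assocLegBasis m k, oblateSectorBasis m ν j⟫_ℂ -
      ((ν ^ 2 : ℝ) : ℂ) * ⟪assocLegBasis m k, mulSq (oblateSectorBasis m ν j)⟫_ℂ =
        (oblateSectorEig m ν j : ℂ) * ⟪assocLegBasis m k, oblateSectorBasis m ν j⟫_ℂ :=
  (exists_hilbertBasis_oblateSpheroidal m ν).choose_spec.choose_spec.choose_spec

/-- The sector basis is the inclusion of its index set. [folklore] -/
theorem coe_oblateSectorBasis :
    ⇑(oblateSectorBasis m ν) = ((↑) : oblateSectorSet m ν → Lp ℂ 2 legendreMeasure) :=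
  (oblateSector_spec m ν).1

/-- **Discreteness**: the sector eigenvalues tend to `+∞`. [folklore] -/
theorem tendsto_oblateSectorEig : Tendsto (oblateSectorEig m ν) cofinite atTop :=
  (oblateSector_spec m ν).2.1

/-- **DRSR (33) in the sector `m`**: `m(m+1) - ν² ≤ λ^{(m)}_j(ν)`.
[cite: DafermosRodnianskiShlapentokhrothman2014, §5.2.1 (33)] -/
theorem le_oblateSectorEig (j : oblateSectorSet m ν) :
    (m : ℝ) * (m + 1) - ν ^ 2 ≤ oblateSectorEig m ν j :=
  (oblateSector_spec m ν).2.2.1 j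

/-- **Weak eigen-equation of the sector basis** against the associated-Legendre Hilbert basis.
[cite: DafermosRodnianskiShlapentokhrothman2014, §5.2.1 (32)] -/
theorem oblateSector_weak (j : oblateSectorSet m ν) (k : ℕ) :
    (assocLegLevel m k : ℂ) * ⟪assocLegBasis m k, oblateSectorBasis m ν j⟫_ℂ -
      ((ν ^ 2 : ℝ) : ℂ) * ⟪assocLegBasis m k, mulSq (oblateSectorBasis m ν j)⟫_ℂ =
        (oblateSectorEig m ν j : ℂ) * ⟪assocLegBasis m k, oblateSectorBasis m ν j⟫_ℂ :=
  (oblateSector_spec m ν).2.2.2 j k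

/-- **Weak eigen-equation of the sector basis against weighted polynomials**
`(1 - x²)^{m/2} p(x)`:
`⟨S, (1-x²)^{m/2} A_m p⟩ - ν² ⟨S, x² (1-x²)^{m/2} p⟩ = λ ⟨S, (1-x²)^{m/2} p⟩`.
[cite: DafermosRodnianskiShlapentokhrothman2014, §5.2.1 (32)] -/
theorem oblateSector_weak_poly (j : oblateSectorSet m ν) (p : ℝ[X]) :
    ⟪(oblateSectorBasis m ν j : Lp ℂ 2 legendreMeasure), assocLegL2 m (assocLegOp m p)⟫_ℂ -
      ((ν ^ 2 : ℝ) : ℂ) * ⟪(oblateSectorBasis m ν j : Lp ℂ 2 legendreMeasure),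
        mulSq (assocLegL2 m p)⟫_ℂ =
      (oblateSectorEig m ν j : ℂ) *
        ⟪(oblateSectorBasis m ν j : Lp ℂ 2 legendreMeasure), assocLegL2 m p⟫_ℂ :=
  inner_oblateSpheroidal_assocLegOp (oblateSector_weak m ν j) p

/-- **DRSR (34) in the sector `m`**: `2 m |ν| - ν² ≤ λ^{(m)}_j(ν)`.
[cite: DafermosRodnianskiShlapentokhrothman2014, §5.2.1 (34)] -/
theorem two_mul_abs_le_oblateSectorEig (j : oblateSectorSet m ν) :
    2 * m * |ν| - ν ^ 2 ≤ oblateSectorEig m ν j :=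
  lowerBound_of_hilbertBasis (oblateSectorBasis m ν) (oblateSectorEig m ν) (oblateSector_weak m ν) j

end Sector

/-! ### The product space `L²([-1, 1] × 𝕋)` and multiplication by `x²` -/

section Sphere

variable (T : ℝ) [hT : Fact (0 < T)]

/-- The measure `dx ⊗ dφ` on `[-1, 1] × 𝕋_T` (Lebesgue on `[-1,1]` times the Haar probability
measure of the circle of length `T`); for `T = 2π` and `x = cos θ` this is `sin θ dθ dφ / 2π`.
[folklore] -/
abbrev sphereMeasure : Measure (ℝ × AddCircle T) :=
  legendreMeasure.prod AddCircle.haarAddCircle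

/-- **Multiplication by `x²` in the first variable** on `L²([-1, 1] × 𝕋)` (the truncated weight
`min (x²) 1`, equal to `x²` on `[-1, 1]`). [folklore] -/
def mulSqFst : Lp ℂ 2 (sphereMeasure T) →L[ℂ] Lp ℂ 2 (sphereMeasure T) :=
  bddMul (sphereMeasure T) (measurable_sqWeight.comp measurable_fst) fun z ↦ abs_sqWeight_le z.1

variable {T}

/-- Almost every point of `[-1, 1] × 𝕋` has first coordinate in `[-1, 1]`. [folklore] -/
theorem ae_fst_mem_Icc : ∀ᵐ z ∂sphereMeasure T, z.1 ∈ Icc (-1 : ℝ) 1 :=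
  (Measure.quasiMeasurePreserving_fst (μ := legendreMeasure)
    (ν := (AddCircle.haarAddCircle : Measure (AddCircle T)))).ae
    (ae_legendreMeasure_of_forall_mem (p := fun x ↦ x ∈ Icc (-1 : ℝ) 1) fun _ hx ↦ hx)

/-- `(x² · F)(x, φ) = x² F(x, φ)` a.e. [folklore] -/
theorem coeFn_mulSqFst (F : Lp ℂ 2 (sphereMeasure T)) :
    (mulSqFst T F : ℝ × AddCircle T → ℂ) =ᵐ[sphereMeasure T]
      fun z ↦ ((z.1 ^ 2 : ℝ) : ℂ) * F z := by
  filter_upwards [coeFn_bddMul (sphereMeasure T) (measurable_sqWeight.comp measurable_fst)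
    (fun z ↦ abs_sqWeight_le z.1) F, ae_fst_mem_Icc (T := T)] with z hz hmem
  rw [mulSqFst, hz, Function.comp_apply, sqWeight_of_mem hmem]

/-- Symmetry of `x² ·` on the product. [folklore] -/
theorem inner_mulSqFst_comm (F G : Lp ℂ 2 (sphereMeasure T)) :
    ⟪mulSqFst T F, G⟫_ℂ = ⟪F, mulSqFst T G⟫_ℂ :=
  inner_bddMul_comm _ _ _ F G

/-- **`x²` acts on elementary tensors in the first factor**: `x² (f ⊗ g) = (x² f) ⊗ g`.
[folklore] -/
theorem mulSqFst_tensorLp (f : Lp ℂ 2 legendreMeasure)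
    (g : Lp ℂ 2 (AddCircle.haarAddCircle : Measure (AddCircle T))) :
    mulSqFst T (tensorLp f g) = tensorLp (mulSq f) g := by
  refine Lp.ext ?_
  have h1 := (Measure.quasiMeasurePreserving_fst (μ := legendreMeasure)
    (ν := (AddCircle.haarAddCircle : Measure (AddCircle T)))).ae_eq_comp (coeFn_mulSq f)
  filter_upwards [coeFn_mulSqFst (tensorLp f g), coeFn_tensorLp (𝕜 := ℂ) f g,
    coeFn_tensorLp (𝕜 := ℂ) (mulSq f) g, h1] with z hz hfg hmfg hm
  rw [hz, hfg, hmfg]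
  have hm' : (mulSq f : ℝ → ℂ) z.1 = ((z.1 ^ 2 : ℝ) : ℂ) * f z.1 := hm
  rw [hm', mul_assoc]

/-! ### The joint basis -/

/-- The index set of the oblate spheroidal harmonics: pairs `⟨m, j⟩` of an azimuthal number
`m ∈ ℤ` and an index `j` of the sector `|m|`. [folklore] -/
abbrev OblateSphereIndex (ν : ℝ) : Type := Σ m : ℤ, oblateSectorSet m.natAbs ν

variable (T) in
/-- **The oblate spheroidal harmonics `Ψ_{⟨m,j⟩} = S^{(|m|)}_j(x) e_m(φ)`**, a Hilbert basis of
`L²([-1, 1] × 𝕋)` (complete orthonormality of `S_{mℓ}(ν, cos θ) e^{imφ}` in `L²(sin θ dθ dφ)`).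
[cite: DafermosRodnianskiShlapentokhrothman2014, §5.2.1, PDF p. 20] -/
def oblateSphereBasis (ν : ℝ) :
    HilbertBasis (OblateSphereIndex ν) ℂ (Lp ℂ 2 (sphereMeasure T)) :=
  fibredTensorBasis (fun m : ℤ ↦ oblateSectorBasis m.natAbs ν) (fourierBasis (T := T))

/-- `Ψ_{⟨m, j⟩} = S^{(|m|)}_j ⊗ e_m`. [folklore] -/
theorem oblateSphereBasis_apply (ν : ℝ) (q : OblateSphereIndex ν) :
    oblateSphereBasis T ν q =
      tensorLp (oblateSectorBasis q.1.natAbs ν q.2 : Lp ℂ 2 legendreMeasure)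
        (fourierLp (T := T) 2 q.1) := by
  rw [oblateSphereBasis, fibredTensorBasis_apply, coe_fourierBasis]

/-- **The eigenvalue `λ_{⟨m,j⟩}(ν) = λ^{(|m|)}_j(ν)` of `Ψ_{⟨m,j⟩}`.**
[cite: DafermosRodnianskiShlapentokhrothman2014, §5.2.1 (32)] -/
def oblateSphereEig (ν : ℝ) (q : OblateSphereIndex ν) : ℝ :=
  oblateSectorEig q.1.natAbs ν q.2

/-- **DRSR (33)**: `|m|(|m|+1) - ν² ≤ λ_{⟨m,j⟩}(ν)`.
[cite: DafermosRodnianskiShlapentokhrothman2014, §5.2.1 (33)] -/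
theorem le_oblateSphereEig (ν : ℝ) (q : OblateSphereIndex ν) :
    |(q.1 : ℝ)| * (|(q.1 : ℝ)| + 1) - ν ^ 2 ≤ oblateSphereEig ν q := by
  have h := le_oblateSectorEig q.1.natAbs ν q.2
  rw [Nat.cast_natAbs, Int.cast_abs] at h
  exact h

/-- **DRSR (34)**: `2 |m| |ν| - ν² ≤ λ_{⟨m,j⟩}(ν)`.
[cite: DafermosRodnianskiShlapentokhrothman2014, §5.2.1 (34)] -/
theorem two_mul_abs_le_oblateSphereEig (ν : ℝ) (q : OblateSphereIndex ν) :
    2 * |(q.1 : ℝ)| * |ν| - ν ^ 2 ≤ oblateSphereEig ν q := by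
  have h := two_mul_abs_le_oblateSectorEig q.1.natAbs ν q.2
  rw [Nat.cast_natAbs, Int.cast_abs] at h
  exact h

/-- **Discreteness of the joint spectrum**: `λ_q(ν) → ∞` along the cofinite filter of the
whole index set (finitely many `m` below any level by (33), finitely many `j` per sector).
[folklore] -/
theorem tendsto_oblateSphereEig (ν : ℝ) : Tendsto (oblateSphereEig ν) cofinite atTop := by
  rw [tendsto_atTop]
  intro B
  -- finitely many sectors can contribute
  obtain ⟨N, hN⟩ := exists_nat_gt (B + ν ^ 2)
  have hfin : {q : OblateSphereIndex ν | ¬B ≤ oblateSphereEig ν q}.Finite := by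
    refine Set.Finite.subset ((Set.finite_Icc (-(N : ℤ)) N).biUnion fun m _ ↦
      ((mem_cofinite.1 ((tendsto_oblateSectorEig m.natAbs ν).eventually
        (eventually_ge_atTop B))).image (Sigma.mk m))) ?_
    rintro ⟨m, j⟩ hq
    have hq' : oblateSectorEig m.natAbs ν j < B := by
      simp only [mem_setOf_eq, not_le] at hq
      exact hq
    refine mem_biUnion (x := m) ?_ ⟨j, fun hj ↦ (not_le.2 hq') hj, rfl⟩
    -- `|m| ≤ N` since `|m|(|m|+1) - ν² ≤ λ < B < N - ν²`
    have h1 := le_oblateSectorEig m.natAbs ν j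
    rw [Nat.cast_natAbs, Int.cast_abs] at h1
    have h2 : |(m : ℝ)| < N := by
      have h0 : (0 : ℝ) ≤ |(m : ℝ)| := abs_nonneg _
      nlinarith
    have h3 : |m| ≤ (N : ℤ) := by
      have : ((|m| : ℤ) : ℝ) ≤ (N : ℝ) := by
        rw [Int.cast_abs]
        exact h2.le
      exact_mod_cast this
    exact mem_Icc.2 (abs_le.1 h3)
  exact mem_cofinite.2 hfin

/-! ### The weak eigen-equation on the product -/

variable (T) in
/-- The unperturbed spherical-harmonic-type tensors `Y_{m,k} = e^{(|m|)}_k ⊗ e_m`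
(`e^{(m)}_k` the associated-Legendre Hilbert basis, `e_m` the Fourier basis). [folklore] -/
def sphHarmTensor (m : ℤ) (k : ℕ) : Lp ℂ 2 (sphereMeasure T) :=
  tensorLp (assocLegBasis m.natAbs k) (fourierLp (T := T) 2 m)

/-- The `Y_{m,k}` form a Hilbert basis of `L²([-1, 1] × 𝕋)` (they are the fibred product of the
associated-Legendre bases with the Fourier basis). [folklore] -/
theorem exists_hilbertBasis_sphHarmTensor :
    ∃ b : HilbertBasis (Σ _ : ℤ, ℕ) ℂ (Lp ℂ 2 (sphereMeasure T)),
      ∀ q, b q = sphHarmTensor T q.1 q.2 :=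
  ⟨fibredTensorBasis (fun m : ℤ ↦ assocLegBasis m.natAbs) (fourierBasis (T := T)), fun q ↦ by
    rw [fibredTensorBasis_apply, coe_fourierBasis, sphHarmTensor]⟩

/-- Orthogonality of Fourier modes: `⟪e_m, e_{m'}⟫ = δ_{m m'}`. [folklore] -/
theorem inner_fourierLp_fourierLp (m m' : ℤ) :
    ⟪fourierLp (T := T) 2 m, fourierLp (T := T) 2 m'⟫_ℂ = if m = m' then 1 else 0 := by
  classical
  have h := orthonormal_iff_ite.1 (orthonormal_fourier (T := T)) m m'
  convert h

/-- **Weak eigen-equation of the oblate spheroidal harmonics on `L²([-1,1] × 𝕋)`**, tested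
against the unperturbed basis `Y_{m,k}`:
`Λ_{|m|,k} ⟪Y_{m,k}, Ψ_q⟫ - ν² ⟪Y_{m,k}, x² Ψ_q⟫ = λ_q ⟪Y_{m,k}, Ψ_q⟫`, where
`Λ_{m,k} = (k+m)(k+m+1)` is the eigenvalue of `Y_{m,k}` under `-Δ_{S²}`; i.e. `Ψ_q` is a weak
eigenfunction of `P(ν) = -Δ_{S²} - ν² cos²θ` with eigenvalue `λ_q`.
[cite: DafermosRodnianskiShlapentokhrothman2014, §5.2.1 (32)] -/
theorem oblateSphere_weak (ν : ℝ) (q : OblateSphereIndex ν) (m : ℤ) (k : ℕ) :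
    (assocLegLevel m.natAbs k : ℂ) * ⟪sphHarmTensor T m k, oblateSphereBasis T ν q⟫_ℂ -
      ((ν ^ 2 : ℝ) : ℂ) * ⟪sphHarmTensor T m k, mulSqFst T (oblateSphereBasis T ν q)⟫_ℂ =
        (oblateSphereEig ν q : ℂ) * ⟪sphHarmTensor T m k, oblateSphereBasis T ν q⟫_ℂ := by
  obtain ⟨m', j⟩ := q
  rw [oblateSphereBasis_apply, mulSqFst_tensorLp, sphHarmTensor, inner_tensorLp_tensorLp,
    inner_tensorLp_tensorLp, inner_fourierLp_fourierLp]
  by_cases hm : m = m'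
  · subst hm
    rw [if_pos rfl, mul_one, mul_one]
    exact oblateSector_weak m.natAbs ν j k
  · rw [if_neg hm, mul_zero, mul_zero, mul_zero, mul_zero, mul_zero, sub_zero]

/-- **Weak eigen-equation against separated polynomial test functions**
`(1 - x²)^{|m|/2} p(x) e_m(φ)` (these span a dense subspace and are restrictions of polynomials
to the sphere):
`⟨Ψ_q, ((1-x²)^{|m|/2} A_{|m|} p) ⊗ e_m⟩ - ν² ⟨Ψ_q, x² ((1-x²)^{|m|/2} p ⊗ e_m)⟩
  = λ_q ⟨Ψ_q, (1-x²)^{|m|/2} p ⊗ e_m⟩`.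
[cite: DafermosRodnianskiShlapentokhrothman2014, §5.2.1 (32)] -/
theorem oblateSphere_weak_poly (ν : ℝ) (q : OblateSphereIndex ν) (m : ℤ) (p : ℝ[X]) :
    ⟪oblateSphereBasis T ν q,
        tensorLp (assocLegL2 m.natAbs (assocLegOp m.natAbs p)) (fourierLp (T := T) 2 m)⟫_ℂ -
      ((ν ^ 2 : ℝ) : ℂ) * ⟪oblateSphereBasis T ν q,
        mulSqFst T (tensorLp (assocLegL2 m.natAbs p) (fourierLp (T := T) 2 m))⟫_ℂ =
      (oblateSphereEig ν q : ℂ) *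
        ⟪oblateSphereBasis T ν q, tensorLp (assocLegL2 m.natAbs p) (fourierLp (T := T) 2 m)⟫_ℂ := by
  obtain ⟨m', j⟩ := q
  rw [oblateSphereBasis_apply, mulSqFst_tensorLp, inner_tensorLp_tensorLp,
    inner_tensorLp_tensorLp, inner_tensorLp_tensorLp, inner_fourierLp_fourierLp]
  by_cases hm : m' = m
  · subst hm
    rw [if_pos rfl, mul_one, mul_one, mul_one]
    exact oblateSector_weak_poly m'.natAbs ν j p
  · rw [if_neg hm, mul_zero, mul_zero, mul_zero, mul_zero, mul_zero, sub_zero]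

/-- **Parseval for the oblate spheroidal harmonics**: `‖F‖² = ∑_q |⟪Ψ_q, F⟫|²` for every
`F ∈ L²([-1, 1] × 𝕋)`. [folklore] -/
theorem hasSum_sq_norm_inner_oblateSphereBasis (ν : ℝ) (F : Lp ℂ 2 (sphereMeasure T)) :
    HasSum (fun q : OblateSphereIndex ν ↦ ‖⟪oblateSphereBasis T ν q, F⟫_ℂ‖ ^ 2) (‖F‖ ^ 2) := by
  have h := hasSum_sq_norm_inner_fibredTensor (𝕜 := ℂ)
    (fun m : ℤ ↦ oblateSectorBasis m.natAbs ν) (fourierBasis (T := T)) F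
  have hfun : (fun q : OblateSphereIndex ν ↦ ‖⟪oblateSphereBasis T ν q, F⟫_ℂ‖ ^ 2) =
      fun q : OblateSphereIndex ν ↦ ‖⟪tensorLp ((fun m : ℤ ↦ oblateSectorBasis m.natAbs ν) q.1 q.2)
        (fourierBasis (T := T) q.1), F⟫_ℂ‖ ^ 2 := by
    funext q
    rw [oblateSphereBasis_apply, coe_fourierBasis]
  rw [hfun]
  exact h

end Sphere

end Literature.Analysis.SpecialFunctions
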